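import Literature.MathematicalPhysics.QuantumFieldTheory.Balaban1983to89.T4ExpWindowSmallField
import Literature.MathematicalPhysics.QuantumLattice.LatticeGaugeDLRProofs
import Mathlib.MeasureTheory.Measure.Lebesgue.EqHaar
import HarnessLib

/-!
# The CONJUGATED left exponential chart of `SU(2)`: a FULL chart whose density does not depend on the conjugating element
# (the second input of the tensoring lemma ✓`VirialFluxGapChartTensor` — layer (B2) of the DIRECT Laplace road to
# ⟨stmt-QuantumFields-24204⟩ `VirialFluxGap.SharpTwistedLaplace`)

Helper module (free-hands work of width seat ym-line-sfw-p2-w3 g57, cell ym-idea-1; `--supports 24204`).  For the residual constant `SU(2)`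
of the tree-gauged ring space every NON-anchor component `x` is parametrised by `b ↦ k·expPoint(b)·R·k⁻¹` (`k = expPoint z` the group
coordinate, `R` the component of the zero `Q_s`); this file records that these maps are FULL charts with the `z`-INDEPENDENT law `expMeasure`
(`w_exp = (2π²)⁻¹ sinc²‖·‖` on the ball of radius `π`, ✓`T4HaarSU2ExpChart`):
* `expMeasure_eq_closedBall` — `expMeasure = (Leb|_{closedBall 0 π}) · w_exp` (the sphere is Lebesgue-null), so the CLOSED ball may serve as
  the window `B₂` of ✓`ChartTensor.restrict_image_tensorWindow_eq_map_withDensity`;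
* ★ `map_conjChart_expMeasure` — `(b ↦ k·expPoint(b)·R·k⁻¹)_* expMeasure = Haar` for all `k, R` (✓`map_expPoint_expMeasure` and two-sided
  invariance ✓`measurePreserving_mul_mul_inv_haarProbability`);
* `surjOn_conjChart_closedBall` — `b ↦ k·expPoint(b)·R·k⁻¹` maps `closedBall 0 π` ONTO `SU(2)` (✓`image_expPoint_closedBall`);
* ★ `map_pi_conjChart` ∕ `surjOn_pi_conjChart_closedBall` — the same for finitely many components at once (`Measure.pi`, Mathlib
  `measurePreserving_pi`), i.e. the hypotheses `hchart₂` ∕ `hsurj` of the tensoring lemma for `X₂ = SU2^ι`.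
Everything here is PROVED; no definitions, no named facts (namespace `Summit.QuantumFields.YangMills.Theorems.VirialFluxGap.ConjChart`).
HONEST FRAMING: measure-theoretic plumbing; ⟨24204⟩, ⟨24319⟩ and every rung stay OPEN; the Yang–Mills mass gap (Clay) is NOT touched; no summit
is proved by a line.

## References
* S. Helgason, *Groups and Geometric Analysis* (2000), Ch. I §1 Thm 1.14 (Haar measure in exponential coordinates). [Helgason2000]
* K. W. Breitung, *Asymptotic Approximations for Probability Integrals*, LNM 1592 (1994), §2.3 Definitions 4–5. [Breitung1994]
-/

set_option autoImplicit false

noncomputable section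

open MeasureTheory Set Filter Metric
open scoped ENNReal
open Literature.MathematicalPhysics.QuantumLattice
open Literature.MathematicalPhysics.QuantumFieldTheory (haarProbability)
open Literature.MathematicalPhysics.QuantumFieldTheory.Balaban1983to89.T4HaarSU2ExpChart
open Literature.MathematicalPhysics.QuantumFieldTheory.Balaban1983to89.T4ExpWindowSmallField

namespace Summit.QuantumFields.YangMills.Theorems.VirialFluxGap.ConjChart

/-- The closed ball may replace the open ball in the chart law: `expMeasure = (Leb|_{closedBall 0 π})·w_exp` (the sphere of radius `π` is
Lebesgue-null). [folklore] -/
theorem expMeasure_eq_closedBall :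
    expMeasure = ((volume : Measure (EuclideanSpace ℝ (Fin 3))).restrict (closedBall (0 : EuclideanSpace ℝ (Fin 3)) Real.pi)).withDensity
      fun x => ENNReal.ofReal (expWeight x) := by
  have hae : ball (0 : EuclideanSpace ℝ (Fin 3)) Real.pi =ᵐ[(volume : Measure (EuclideanSpace ℝ (Fin 3)))]
      closedBall (0 : EuclideanSpace ℝ (Fin 3)) Real.pi :=
    ae_eq_of_subset_of_measure_ge ball_subset_closedBall (by rw [Measure.addHaar_closedBall_eq_addHaar_ball])
      measurableSet_ball.nullMeasurableSet measure_closedBall_lt_top.ne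
  rw [expMeasure, Measure.restrict_congr_set hae]

/-- ★ **The conjugated left exponential chart pushes the chart law to Haar measure**: `(b ↦ k·expPoint(b)·R·k⁻¹)_* expMeasure = Haar` for all
`k, R ∈ SU(2)` (its density does not depend on `k`). [cite: Helgason2000, Ch. I §1 Thm 1.14] -/
theorem map_conjChart_expMeasure (k R : Matrix.specialUnitaryGroup (Fin 2) ℂ) :
    expMeasure.map (fun b : EuclideanSpace ℝ (Fin 3) => k * (expPoint b * R) * k⁻¹) =
      haarProbability (Matrix.specialUnitaryGroup (Fin 2) ℂ) := by
  have hpres := measurePreserving_mul_mul_inv_haarProbability (G := Matrix.specialUnitaryGroup (Fin 2) ℂ) k (k * R⁻¹)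
  have hfun : (fun b : EuclideanSpace ℝ (Fin 3) => k * (expPoint b * R) * k⁻¹) =
      (fun x : Matrix.specialUnitaryGroup (Fin 2) ℂ => k * x * (k * R⁻¹)⁻¹) ∘ expPoint := by
    funext b
    simp only [Function.comp_apply, mul_inv_rev, inv_inv, mul_assoc]
  rw [hfun, ← Measure.map_map hpres.measurable measurable_expPoint, map_expPoint_expMeasure, hpres.map_eq]

/-- The same with the closed-ball chart law `(Leb|_{closedBall 0 π})·w_exp` (the `hchart₂` hypothesis of the tensoring lemma for one component).
[cite: Helgason2000, Ch. I §1 Thm 1.14] -/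
theorem map_conjChart_withDensity_closedBall (k R : Matrix.specialUnitaryGroup (Fin 2) ℂ) :
    ((((volume : Measure (EuclideanSpace ℝ (Fin 3))).restrict (closedBall (0 : EuclideanSpace ℝ (Fin 3)) Real.pi)).withDensity
        fun x => ENNReal.ofReal (expWeight x)).map (fun b : EuclideanSpace ℝ (Fin 3) => k * (expPoint b * R) * k⁻¹)) =
      haarProbability (Matrix.specialUnitaryGroup (Fin 2) ℂ) := by
  rw [← expMeasure_eq_closedBall, map_conjChart_expMeasure]

/-- **The conjugated chart maps the closed ball of radius `π` ONTO `SU(2)`** (the `hsurj` hypothesis). [folklore] -/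
theorem surjOn_conjChart_closedBall (k R : Matrix.specialUnitaryGroup (Fin 2) ℂ) :
    SurjOn (fun b : EuclideanSpace ℝ (Fin 3) => k * (expPoint b * R) * k⁻¹) (closedBall (0 : EuclideanSpace ℝ (Fin 3)) Real.pi) univ := by
  intro U _
  have hU : k⁻¹ * U * k * R⁻¹ ∈ expPoint '' closedBall (0 : EuclideanSpace ℝ (Fin 3)) Real.pi := by
    rw [image_expPoint_closedBall]; exact mem_univ _
  obtain ⟨b, hb, hbU⟩ := hU
  refine ⟨b, hb, ?_⟩
  simp only [hbU]
  group

/-! ## Finitely many components at once -/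

/-- ★ **Product version**: for `k ∈ SU(2)` and base points `R : ι → SU(2)` the componentwise conjugated chart pushes the product chart law to
product Haar measure (the `hchart₂` hypothesis of ✓`ChartTensor.restrict_image_tensorWindow_eq_map_withDensity` for `X₂ = SU2^ι`).
[cite: Helgason2000, Ch. I §1 Thm 1.14] -/
theorem map_pi_conjChart {ι : Type*} [Fintype ι] (k : Matrix.specialUnitaryGroup (Fin 2) ℂ) (R : ι → Matrix.specialUnitaryGroup (Fin 2) ℂ) :
    (Measure.pi fun _ : ι => expMeasure).map
        (fun b : ι → EuclideanSpace ℝ (Fin 3) => fun i => k * (expPoint (b i) * R i) * k⁻¹) =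
      Measure.pi fun _ : ι => haarProbability (Matrix.specialUnitaryGroup (Fin 2) ℂ) := by
  have h : ∀ i : ι, MeasurePreserving (fun b : EuclideanSpace ℝ (Fin 3) => k * (expPoint b * R i) * k⁻¹) expMeasure
      (haarProbability (Matrix.specialUnitaryGroup (Fin 2) ℂ)) := fun i =>
    ⟨((continuous_const.mul ((continuous_expPoint).mul continuous_const)).mul continuous_const).measurable, map_conjChart_expMeasure k (R i)⟩
  exact (measurePreserving_pi (fun _ : ι => expMeasure) (fun _ : ι => haarProbability (Matrix.specialUnitaryGroup (Fin 2) ℂ)) h).map_eq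

/-- **Product version of the surjectivity**: the componentwise conjugated chart maps `Π closedBall 0 π` onto `SU(2)^ι`. [folklore] -/
theorem surjOn_pi_conjChart_closedBall {ι : Type*} (k : Matrix.specialUnitaryGroup (Fin 2) ℂ) (R : ι → Matrix.specialUnitaryGroup (Fin 2) ℂ) :
    SurjOn (fun b : ι → EuclideanSpace ℝ (Fin 3) => fun i => k * (expPoint (b i) * R i) * k⁻¹)
      (Set.pi univ fun _ : ι => closedBall (0 : EuclideanSpace ℝ (Fin 3)) Real.pi) univ := by
  intro U _
  choose b hb hbU using fun i => surjOn_conjChart_closedBall k (R i) (mem_univ (U i))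
  exact ⟨b, fun i _ => hb i, funext fun i => hbU i⟩

end Summit.QuantumFields.YangMills.Theorems.VirialFluxGap.ConjChart

end
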